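import Summits.AtomisticToContinuum.FouriersLaw.Theses.MatthiessenLadder
import Literature.MathematicalPhysics.KineticTheory.ReyBelletThomas2002
import Literature.Probability.Process.KrylovBogoliubovCesaro
import HarnessLib

/-!
# `PrefixSteadyStates`, line `registered` — stub `stub_steadyStateOfSemigroupBound`

Crux item `stmt-AtomisticToContinuum-12778` (route `MatthiessenLadder`, decl `…MatthiessenLadder.
PrefixSteadyStates`), soft half of the existence clause: for `cellChain ω₂ lam β γ c` (`ω₂ > 0`,
`lam, β ≥ 0`, any `c`, `N`, real `γ, T_L, T_R`), a Feller `MarkovSemigroupFor` the rung's generator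
with bounded Cesàro means of `(1 + H)²` along one orbit yields a weak `SiteChain.IsSteadyState`:
(1) Krylov–Bogoliubov, Cesàro form (`MarkovSemigroup.exists_invariant_of_cesaro_bound`) with the
coercive observable `W = (1 + H)²` (`H ≥ ∑ p_i²/2 + ω₂ ∑ q_i²/2 ≥ 0`, so `{W ≤ R}` is a closed subset
of a box) — an invariant probability measure `μ` with `∫⁻ (1+H)² dμ ≤ C`; (2) weak stationarity by
`MarkovSemigroupFor.IsInvariant.integral_generator_eq_zero` (Dynkin + invariance + Fubini), `L f`
being continuous with compact support for `f ∈ C_c^∞` (`SiteChain` ports of the `OscillatorChain`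
lemmas of `LangevinChainNESSProofs.lean`, same generator formula); (3) the currents
`-(p_i + p_{i+1})/2 · (r + β_i r³)`, `β_i ∈ {0, β}`, obey `|j_i| ≤ N (3+β)/2 · (1+H)²` (algebra of
`pinnedChain_abs_bondCurrent_le`, sitewise via `cellChain_V`) and are continuous, so `μ`-integrable.
-/

noncomputable section

namespace Summit.AtomisticToContinuum.FouriersLaw.Theorems.PrefixSteadyStates.LineRegistered

open MeasureTheory ProbabilityTheory Filter Topology Set
open scoped NNReal ENNReal BoundedContinuousFunction ContDiff
open Literature.MathematicalPhysics.KineticTheory.HeatConduction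
open Literature.Probability.Process

/-! ### The generator of a site chain on test functions (ports of the `OscillatorChain` lemmas) -/

/-- The Hamiltonian of a site chain is as smooth as its potentials. [folklore] -/
theorem siteChain_contDiff_hamiltonian (P : SiteChain) {n : WithTop ℕ∞}
    (hU : ∀ i, ContDiff ℝ n (P.U i)) (hV : ∀ i, ContDiff ℝ n (P.V i)) (N : ℕ) :
    ContDiff ℝ n (P.hamiltonian N) := by
  unfold SiteChain.hamiltonian
  have hq : ∀ i : Fin N, ContDiff ℝ n fun x : PhaseSpace N => x.1 i := fun i =>
    (contDiff_apply ℝ ℝ i).comp contDiff_fst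
  have hp : ∀ i : Fin N, ContDiff ℝ n fun x : PhaseSpace N => x.2 i := fun i =>
    (contDiff_apply ℝ ℝ i).comp contDiff_snd
  apply ContDiff.add
  · exact ContDiff.sum fun i _ => (((hp i).pow 2).div_const 2).add ((hU i.val).comp (hq i))
  · refine ContDiff.sum fun i _ => ContDiff.sum fun j _ => ?_
    by_cases h : j.val = i.val + 1
    · simp only [h, if_true]
      exact (hV i.val).comp ((hq j).sub (hq i))
    · simp only [h, if_false]
      exact contDiff_const

/-- For `C¹` site potentials and `f ∈ C²`, `L f` is continuous. [folklore] -/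
theorem siteChain_continuous_generator (P : SiteChain) (hU : ∀ i, ContDiff ℝ 1 (P.U i))
    (hV : ∀ i, ContDiff ℝ 1 (P.V i)) (N : ℕ) (T_L T_R : ℝ) {f : PhaseSpace N → ℝ}
    (hf : ContDiff ℝ 2 f) : Continuous (P.generator N T_L T_R f) := by
  have hH : ContDiff ℝ 1 (P.hamiltonian N) := siteChain_contDiff_hamiltonian P hU hV N
  have h2 : (2 : WithTop ℕ∞) ≠ 0 := by norm_num
  have hq : ∀ i : Fin N, Continuous (partialQ i f) := fun i => continuous_partialQ hf h2 i
  have hp : ∀ i : Fin N, Continuous (partialP i f) := fun i => continuous_partialP hf h2 i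
  have hpp : ∀ i : Fin N, Continuous (partialP i (partialP i f)) := fun i =>
    continuous_partialP (contDiff_partialP hf (m := 1) (by norm_num) i) one_ne_zero i
  have hqH : ∀ i : Fin N, Continuous (partialQ i (P.hamiltonian N)) := fun i =>
    continuous_partialQ hH one_ne_zero i
  have hx2 : ∀ i : Fin N, Continuous fun x : PhaseSpace N => x.2 i := fun i =>
    (continuous_apply i).comp continuous_snd
  unfold SiteChain.generator
  refine Continuous.add (continuous_finsetSum _ fun i _ =>
    ((hx2 i).mul (hq i)).sub ((hqH i).mul (hp i))) (continuous_const.mul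
      (continuous_finsetSum _ fun i _ => Continuous.add ?_ ?_))
  · by_cases h : i.val = 0
    · simp only [h, if_true]
      exact (continuous_const.mul (hpp i)).sub ((hx2 i).mul (hp i))
    · simp only [h, if_false]
      exact continuous_const
  · by_cases h : i.val = N - 1
    · simp only [h, if_true]
      exact (continuous_const.mul (hpp i)).sub ((hx2 i).mul (hp i))
    · simp only [h, if_false]
      exact continuous_const

/-- For `f ∈ C²_c`, `L f` has compact support (every term carries a derivative of `f`).
[folklore] -/
theorem siteChain_hasCompactSupport_generator (P : SiteChain) (N : ℕ) (T_L T_R : ℝ)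
    {f : PhaseSpace N → ℝ} (hf : ContDiff ℝ 2 f) (hfc : HasCompactSupport f) :
    HasCompactSupport (P.generator N T_L T_R f) := by
  have hd : Differentiable ℝ f := hf.differentiable (by norm_num)
  have hd1 : ∀ i : Fin N, Differentiable ℝ (partialP i f) := fun i =>
    (contDiff_partialP hf (m := 1) (by norm_num) i).differentiable one_ne_zero
  have hq : ∀ i : Fin N, HasCompactSupport (partialQ i f) := fun i =>
    hasCompactSupport_partialQ hd hfc i
  have hp : ∀ i : Fin N, HasCompactSupport (partialP i f) := fun i =>
    hasCompactSupport_partialP hd hfc i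
  have hpp : ∀ i : Fin N, HasCompactSupport (partialP i (partialP i f)) := fun i =>
    hasCompactSupport_partialP (hd1 i) (hp i) i
  simp only [hasCompactSupport_iff_eventuallyEq] at hq hp hpp ⊢
  have hq' : ∀ᶠ x in Filter.coclosedCompact (PhaseSpace N), ∀ i, partialQ i f x = 0 :=
    Filter.eventually_all.mpr fun i => (hq i).mono fun x hx => hx
  have hp' : ∀ᶠ x in Filter.coclosedCompact (PhaseSpace N), ∀ i, partialP i f x = 0 :=
    Filter.eventually_all.mpr fun i => (hp i).mono fun x hx => hx
  have hpp' : ∀ᶠ x in Filter.coclosedCompact (PhaseSpace N),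
      ∀ i, partialP i (partialP i f) x = 0 :=
    Filter.eventually_all.mpr fun i => (hpp i).mono fun x hx => hx
  filter_upwards [hq', hp', hpp'] with x hxq hxp hxpp
  simp [SiteChain.generator, hxq, hxp, hxpp]

/-! ### The cell chain: smooth potentials, energy bounds, currents -/

section CellChain

variable {ω₂ lam β : ℝ}

/-- The site potentials of the cell chain are smooth. [folklore] -/
theorem cellChain_contDiff_U (ω₂ lam β γ : ℝ) (c : ℕ → Bool) (i : ℕ) {n : WithTop ℕ∞} :
    ContDiff ℝ n ((cellChain ω₂ lam β γ c).U i) := by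
  rw [cellChain_U]; exact pinnedChain_contDiff_U _ _ _ _

/-- The bond potentials of the cell chain are smooth. [folklore] -/
theorem cellChain_contDiff_V (ω₂ lam β γ : ℝ) (c : ℕ → Bool) (i : ℕ) {n : WithTop ℕ∞} :
    ContDiff ℝ n ((cellChain ω₂ lam β γ c).V i) := by
  rw [cellChain_V]; exact pinnedChain_contDiff_V _ _ _ _

/-- `V_i'(r) = r + β_i r³` with `β_i = β` at a cell and `0` elsewhere. [folklore] -/
theorem cellChain_deriv_V (ω₂ lam β γ : ℝ) (c : ℕ → Bool) (i : ℕ) (r : ℝ) :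
    deriv ((cellChain ω₂ lam β γ c).V i) r = r + (if c i then β else 0) * r ^ 3 := by
  rw [cellChain_V, pinnedChain_deriv_V]

/-- The switched quartic amplitude is nonnegative. [folklore] -/
theorem ite_amplitude_nonneg {a : ℝ} (ha : 0 ≤ a) (b : Bool) : 0 ≤ (if b then a else 0 : ℝ) := by
  split_ifs <;> [exact ha; exact le_rfl]

/-- The switched quartic amplitude is at most the full amplitude. [folklore] -/
theorem ite_amplitude_le {a : ℝ} (ha : 0 ≤ a) (b : Bool) : (if b then a else 0 : ℝ) ≤ a := by
  split_ifs <;> [exact le_rfl; exact ha]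

/-- `ω₂ q²/2 ≤ U_i(q)` for `lam ≥ 0`. [folklore] -/
theorem cellChain_sq_le_U (hl : 0 ≤ lam) (ω₂ β γ : ℝ) (c : ℕ → Bool) (i : ℕ) (q : ℝ) :
    ω₂ * q ^ 2 / 2 ≤ (cellChain ω₂ lam β γ c).U i q := by
  show ω₂ * q ^ 2 / 2 ≤ ω₂ * q ^ 2 / 2 + (if c i then lam else 0) * q ^ 4 / 4
  have := ite_amplitude_nonneg hl (c i)
  exact le_add_of_nonneg_right (by positivity)

/-- `V_i ≥ 0` for `β ≥ 0`. [folklore] -/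
theorem cellChain_V_nonneg (hβ : 0 ≤ β) (ω₂ lam γ : ℝ) (c : ℕ → Bool) (i : ℕ) (r : ℝ) :
    0 ≤ (cellChain ω₂ lam β γ c).V i r := by
  show 0 ≤ r ^ 2 / 2 + (if c i then β else 0) * r ^ 4 / 4
  have := ite_amplitude_nonneg hβ (c i)
  positivity

/-- `∑_i ω₂ q_i²/2 + ∑_i p_i²/2 ≤ H(q,p)` for the cell chain with `lam, β ≥ 0`. [folklore] -/
theorem cellChain_harmonic_le_hamiltonian (hl : 0 ≤ lam) (hβ : 0 ≤ β) (ω₂ γ : ℝ) (c : ℕ → Bool)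
    (N : ℕ) (x : PhaseSpace N) :
    (∑ i, ω₂ * x.1 i ^ 2 / 2) + ∑ i, x.2 i ^ 2 / 2 ≤ (cellChain ω₂ lam β γ c).hamiltonian N x := by
  unfold SiteChain.hamiltonian
  have h1 : (∑ i, ω₂ * x.1 i ^ 2 / 2) + ∑ i, x.2 i ^ 2 / 2 ≤
      ∑ i : Fin N, (x.2 i ^ 2 / 2 + (cellChain ω₂ lam β γ c).U i.val (x.1 i)) := by
    rw [← Finset.sum_add_distrib]
    refine Finset.sum_le_sum fun i _ => ?_
    have h0 := cellChain_sq_le_U hl ω₂ β γ c i.val (x.1 i)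
    linarith
  have h2 : 0 ≤ ∑ i : Fin N, ∑ j : Fin N,
      if j.val = i.val + 1 then (cellChain ω₂ lam β γ c).V i.val (x.1 j - x.1 i) else 0 := by
    refine Finset.sum_nonneg fun i _ => Finset.sum_nonneg fun j _ => ?_
    split_ifs
    · exact cellChain_V_nonneg hβ ω₂ lam γ c _ _
    · exact le_rfl
  linarith

/-- `H ≥ 0` for the cell chain with `ω₂, lam, β ≥ 0`. [folklore] -/
theorem cellChain_hamiltonian_nonneg (hω : 0 ≤ ω₂) (hl : 0 ≤ lam) (hβ : 0 ≤ β) (γ : ℝ)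
    (c : ℕ → Bool) (N : ℕ) (x : PhaseSpace N) :
    0 ≤ (cellChain ω₂ lam β γ c).hamiltonian N x := by
  have h := cellChain_harmonic_le_hamiltonian hl hβ ω₂ γ c N x
  have h1 : 0 ≤ ∑ k, ω₂ * x.1 k ^ 2 / 2 := Finset.sum_nonneg fun k _ => by positivity
  have h2 : 0 ≤ ∑ k : Fin N, x.2 k ^ 2 / 2 := Finset.sum_nonneg fun k _ => by positivity
  linarith

/-- One harmonic and one kinetic term are bounded by the energy. [folklore] -/
theorem cellChain_coord_sq_le_hamiltonian (hω : 0 ≤ ω₂) (hl : 0 ≤ lam) (hβ : 0 ≤ β) (γ : ℝ)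
    (c : ℕ → Bool) (N : ℕ) (x : PhaseSpace N) (i : Fin N) :
    ω₂ * x.1 i ^ 2 / 2 ≤ (cellChain ω₂ lam β γ c).hamiltonian N x ∧
      x.2 i ^ 2 / 2 ≤ (cellChain ω₂ lam β γ c).hamiltonian N x := by
  have h := cellChain_harmonic_le_hamiltonian hl hβ ω₂ γ c N x
  have h1 : ω₂ * x.1 i ^ 2 / 2 ≤ ∑ k, ω₂ * x.1 k ^ 2 / 2 :=
    Finset.single_le_sum (f := fun k => ω₂ * x.1 k ^ 2 / 2) (fun k _ => by positivity)
      (Finset.mem_univ i)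
  have h2 : x.2 i ^ 2 / 2 ≤ ∑ k, x.2 k ^ 2 / 2 :=
    Finset.single_le_sum (f := fun k => x.2 k ^ 2 / 2) (fun k _ => by positivity)
      (Finset.mem_univ i)
  have h3 : 0 ≤ ∑ k, ω₂ * x.1 k ^ 2 / 2 := Finset.sum_nonneg fun k _ => by positivity
  have h4 : 0 ≤ ∑ k : Fin N, x.2 k ^ 2 / 2 := Finset.sum_nonneg fun k _ => by positivity
  exact ⟨by linarith, by linarith⟩

/-- Two distinct kinetic terms are bounded by the energy. [folklore] -/
theorem cellChain_sq_add_sq_le_hamiltonian (hl : 0 ≤ lam) (hβ : 0 ≤ β) (ω₂ γ : ℝ)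
    (c : ℕ → Bool) (N : ℕ) (x : PhaseSpace N) {i j : Fin N} (hij : i ≠ j) (hω : 0 ≤ ω₂) :
    x.2 i ^ 2 / 2 + x.2 j ^ 2 / 2 ≤ (cellChain ω₂ lam β γ c).hamiltonian N x := by
  have h := cellChain_harmonic_le_hamiltonian hl hβ ω₂ γ c N x
  have h1 : x.2 i ^ 2 / 2 + x.2 j ^ 2 / 2 ≤ ∑ k, x.2 k ^ 2 / 2 := by
    rw [← Finset.sum_pair (f := fun k => x.2 k ^ 2 / 2) hij]
    exact Finset.sum_le_sum_of_subset_of_nonneg (Finset.subset_univ _)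
      (fun k _ _ => by positivity)
  have h2 : 0 ≤ ∑ k, ω₂ * x.1 k ^ 2 / 2 := Finset.sum_nonneg fun k _ => by positivity
  linarith

/-- A single bond energy is bounded by the energy. [folklore] -/
theorem cellChain_bond_le_hamiltonian (hω : 0 ≤ ω₂) (hl : 0 ≤ lam) (hβ : 0 ≤ β) (γ : ℝ)
    (c : ℕ → Bool) (N : ℕ) (x : PhaseSpace N) {i j : Fin N} (hj : j.val = i.val + 1) :
    (x.1 j - x.1 i) ^ 2 / 2 + (if c i.val then β else 0) * (x.1 j - x.1 i) ^ 4 / 4 ≤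
      (cellChain ω₂ lam β γ c).hamiltonian N x := by
  unfold SiteChain.hamiltonian
  have h1 : 0 ≤ ∑ k : Fin N, (x.2 k ^ 2 / 2 + (cellChain ω₂ lam β γ c).U k.val (x.1 k)) :=
    Finset.sum_nonneg fun k _ => add_nonneg (by positivity)
      ((by positivity : (0:ℝ) ≤ ω₂ * x.1 k ^ 2 / 2).trans (cellChain_sq_le_U hl ω₂ β γ c _ _))
  have hnn : ∀ k l : Fin N, 0 ≤ (if l.val = k.val + 1 then
      (cellChain ω₂ lam β γ c).V k.val (x.1 l - x.1 k) else 0) := by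
    intro k l
    split_ifs
    · exact cellChain_V_nonneg hβ ω₂ lam γ c _ _
    · exact le_rfl
  have h2 : (cellChain ω₂ lam β γ c).V i.val (x.1 j - x.1 i) ≤ ∑ k : Fin N, ∑ l : Fin N,
      (if l.val = k.val + 1 then (cellChain ω₂ lam β γ c).V k.val (x.1 l - x.1 k) else 0) := by
    calc (cellChain ω₂ lam β γ c).V i.val (x.1 j - x.1 i)
        = (if j.val = i.val + 1 then (cellChain ω₂ lam β γ c).V i.val (x.1 j - x.1 i) else 0) := by
          rw [if_pos hj]
      _ ≤ ∑ l : Fin N, (if l.val = i.val + 1 then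
          (cellChain ω₂ lam β γ c).V i.val (x.1 l - x.1 i) else 0) :=
          Finset.single_le_sum (f := fun l : Fin N => if l.val = i.val + 1 then
            (cellChain ω₂ lam β γ c).V i.val (x.1 l - x.1 i) else 0) (fun l _ => hnn i l)
            (Finset.mem_univ j)
      _ ≤ ∑ k : Fin N, ∑ l : Fin N,
          (if l.val = k.val + 1 then (cellChain ω₂ lam β γ c).V k.val (x.1 l - x.1 k) else 0) :=
          Finset.single_le_sum (f := fun k : Fin N => ∑ l : Fin N, if l.val = k.val + 1 then
            (cellChain ω₂ lam β γ c).V k.val (x.1 l - x.1 k) else 0)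
            (fun k _ => Finset.sum_nonneg fun l _ => hnn k l) (Finset.mem_univ i)
  have h3 : (cellChain ω₂ lam β γ c).V i.val (x.1 j - x.1 i) =
      (x.1 j - x.1 i) ^ 2 / 2 + (if c i.val then β else 0) * (x.1 j - x.1 i) ^ 4 / 4 := rfl
  linarith

/-- **Polynomial bound on the currents of the cell chain**: `|j_i| ≤ N (3+β)/2 (1 + H)²`
(`ω₂, lam, β ≥ 0`). [folklore] -/
theorem cellChain_abs_bondCurrent_le (hω : 0 ≤ ω₂) (hl : 0 ≤ lam) (hβ : 0 ≤ β) (γ : ℝ)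
    (c : ℕ → Bool) (N : ℕ) (i : Fin N) (x : PhaseSpace N) :
    |(cellChain ω₂ lam β γ c).bondCurrent N i x| ≤
      N * ((3 + β) / 2 * (1 + (cellChain ω₂ lam β γ c).hamiltonian N x) ^ 2) := by
  have hsq := fun k l : Fin N => cellChain_sq_add_sq_le_hamiltonian hl hβ ω₂ γ c N x (i := k)
    (j := l)
  have hbd := fun k l : Fin N => cellChain_bond_le_hamiltonian hω hl hβ γ c N x (i := k) (j := l)
  have hH0 := cellChain_hamiltonian_nonneg hω hl hβ γ c N x
  unfold SiteChain.bondCurrent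
  set E : ℝ := (cellChain ω₂ lam β γ c).hamiltonian N x
  have hb0 : 0 ≤ (if c i.val then β else 0 : ℝ) := ite_amplitude_nonneg hβ _
  have hbβ : (if c i.val then β else 0 : ℝ) ≤ β := ite_amplitude_le hβ _
  have hterm : ∀ j : Fin N, |(if j.val = i.val + 1 then -((x.2 i + x.2 j) / 2 *
      deriv ((cellChain ω₂ lam β γ c).V i.val) (x.1 j - x.1 i)) else 0)| ≤
      (3 + β) / 2 * (1 + E) ^ 2 := by
    intro j
    split_ifs with hj
    · have hij : i ≠ j := by
        rintro rfl
        omega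
      rw [cellChain_deriv_V, abs_neg, abs_mul, abs_div, abs_two]
      have hp := abs_add_le_one_add (hsq i j hij hω)
      have hv := abs_deriv_V_le hb0 (hbd i j hj)
      calc |x.2 i + x.2 j| / 2 * |x.1 j - x.1 i + (if c i.val then β else 0) * (x.1 j - x.1 i) ^ 3|
          ≤ (1 + E) / 2 * ((3 + (if c i.val then β else 0 : ℝ)) * (1 + E)) :=
            mul_le_mul (by linarith) hv (abs_nonneg _) (by positivity)
        _ ≤ (1 + E) / 2 * ((3 + β) * (1 + E)) := by gcongr
        _ = (3 + β) / 2 * (1 + E) ^ 2 := by ring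
    · rw [abs_zero]; positivity
  calc |∑ j : Fin N, (if j.val = i.val + 1 then
          -((x.2 i + x.2 j) / 2 * deriv ((cellChain ω₂ lam β γ c).V i.val) (x.1 j - x.1 i))
          else 0)|
      ≤ ∑ j : Fin N, |(if j.val = i.val + 1 then
          -((x.2 i + x.2 j) / 2 * deriv ((cellChain ω₂ lam β γ c).V i.val) (x.1 j - x.1 i))
          else 0)| := Finset.abs_sum_le_sum_abs _ _
    _ ≤ ∑ _j : Fin N, (3 + β) / 2 * (1 + E) ^ 2 := Finset.sum_le_sum fun j _ => hterm j
    _ = N * ((3 + β) / 2 * (1 + E) ^ 2) := by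
        simp [Finset.sum_const, Finset.card_univ, Fintype.card_fin]

/-- The bond currents of the cell chain are continuous (polynomial). [folklore] -/
theorem cellChain_continuous_bondCurrent (ω₂ lam β γ : ℝ) (c : ℕ → Bool) (N : ℕ) (i : Fin N) :
    Continuous ((cellChain ω₂ lam β γ c).bondCurrent N i) := by
  unfold SiteChain.bondCurrent
  simp only [cellChain_deriv_V]
  refine continuous_finsetSum _ fun j _ => ?_
  by_cases h : j.val = i.val + 1
  · simp only [h, if_true]; fun_prop
  · simp only [h, if_false]; exact continuous_const

/-- The Hamiltonian of the cell chain is continuous. [folklore] -/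
theorem cellChain_continuous_hamiltonian (ω₂ lam β γ : ℝ) (c : ℕ → Bool) (N : ℕ) :
    Continuous ((cellChain ω₂ lam β γ c).hamiltonian N) :=
  (siteChain_contDiff_hamiltonian _ (fun i => cellChain_contDiff_U ω₂ lam β γ c i (n := 0))
    (fun i => cellChain_contDiff_V ω₂ lam β γ c i (n := 0)) N).continuous

/-- **Compact energy shells**: for `ω₂ > 0`, `lam, β ≥ 0` the sublevel sets `{H ≤ M}` of the cell
chain are compact (closed subsets of the box `|q_i| ≤ √(2M/ω₂)`, `|p_i| ≤ √(2M)`). [folklore] -/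
theorem cellChain_isCompact_hamiltonian_le (hω : 0 < ω₂) (hl : 0 ≤ lam) (hβ : 0 ≤ β) (γ : ℝ)
    (c : ℕ → Bool) (N : ℕ) (M : ℝ) :
    IsCompact {x : PhaseSpace N | (cellChain ω₂ lam β γ c).hamiltonian N x ≤ M} := by
  have hK : IsCompact ((Set.univ.pi fun _ : Fin N => Set.Icc (-Real.sqrt (2 * M / ω₂))
      (Real.sqrt (2 * M / ω₂))) ×ˢ
      (Set.univ.pi fun _ : Fin N => Set.Icc (-Real.sqrt (2 * M)) (Real.sqrt (2 * M)))) :=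
    (isCompact_univ_pi fun _ => isCompact_Icc).prod (isCompact_univ_pi fun _ => isCompact_Icc)
  refine hK.of_isClosed_subset
    (isClosed_le (cellChain_continuous_hamiltonian ω₂ lam β γ c N) continuous_const) fun x hx => ?_
  simp only [Set.mem_setOf_eq] at hx
  simp only [Set.mem_prod, Set.mem_univ_pi, Set.mem_Icc]
  constructor
  · intro i
    have h1 := (cellChain_coord_sq_le_hamiltonian hω.le hl hβ γ c N x i).1
    have : x.1 i ^ 2 ≤ 2 * M / ω₂ := by
      rw [le_div_iff₀ hω]
      nlinarith
    exact abs_le.1 (Real.abs_le_sqrt this)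
  · intro i
    have h2 := (cellChain_coord_sq_le_hamiltonian hω.le hl hβ γ c N x i).2
    have : x.2 i ^ 2 ≤ 2 * M := by linarith
    exact abs_le.1 (Real.abs_le_sqrt this)

end CellChain

/-! ### The stub -/

/-- **Stub E-soft — a Feller semigroup with a Cesàro-bounded `(1+H)²`-orbit gives a weak steady
state** (every cell indicator `c`, every size `N`, all real `T_L, T_R, γ`; `ω₂ > 0`, `lam, β ≥ 0`).
Krylov–Bogoliubov in the Cesàro form (`exists_invariant_of_cesaro_bound`: `(1+H)²` is continuous
with compact sublevel sets since `H ≥ ∑ p²/2 + ω₂ ∑ q²/2`) gives an invariant probability measure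
`μ` with `∫ (1+H)² dμ ≤ C`; integrating Dynkin's identity against `μ` and using invariance on both
sides (Fubini) gives `∫ L f dμ = 0` for `f ∈ C_c^∞` (`L f` is continuous with compact support for
the polynomial potentials); the bond currents `-(p_i+p_{i+1})/2 · (r + β_i r³)` are continuous and
dominated by a multiple of `(1+H)²`, hence `μ`-integrable (Da Prato–Zabczyk 1996, Cor. 3.1.2;
Cuneo–Eckmann–Hairer–Rey-Bellet 2018, §3; all ingredients are proved tree facts). [folklore] -/
theorem stub_steadyStateOfSemigroupBound :
    ∀ ω₂ lam β γ : ℝ, 0 < ω₂ → 0 ≤ lam → 0 ≤ β → ∀ (c : ℕ → Bool) (N : ℕ) (T_L T_R : ℝ),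
      (∃ S : MarkovSemigroupFor ((cellChain ω₂ lam β γ c).generator N T_L T_R),
          (∀ (t : ℝ≥0) (g : PhaseSpace N →ᵇ ℝ), Continuous fun x => ∫ y, g y ∂(S.kernel t x)) ∧
          ∃ (x₀ : PhaseSpace N) (C : ℝ≥0), ∀ n : ℕ,
            ∫⁻ s in Set.Ioc (0 : ℝ) (n + 1),
                ∫⁻ y, ENNReal.ofReal ((1 + (cellChain ω₂ lam β γ c).hamiltonian N y) ^ 2)
                  ∂(S.kernel s.toNNReal x₀) ≤ ((n : ℝ≥0∞) + 1) * C) →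
      ∃ μ : Measure (PhaseSpace N), (cellChain ω₂ lam β γ c).IsSteadyState N T_L T_R μ := by
  intro ω₂ lam β γ hω hl hβ c N T_L T_R hS
  obtain ⟨S, hFeller, x₀, C, hC⟩ := hS
  -- regularity of the data
  have hU1 : ∀ i, ContDiff ℝ 1 ((cellChain ω₂ lam β γ c).U i) := fun i =>
    cellChain_contDiff_U ω₂ lam β γ c i
  have hV1 : ∀ i, ContDiff ℝ 1 ((cellChain ω₂ lam β γ c).V i) := fun i =>
    cellChain_contDiff_V ω₂ lam β γ c i
  have hHc : Continuous ((cellChain ω₂ lam β γ c).hamiltonian N) :=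
    cellChain_continuous_hamiltonian ω₂ lam β γ c N
  -- the coercive observable `W = (1 + H)²`
  set W : PhaseSpace N → ℝ≥0 := fun y =>
    ((1 + (cellChain ω₂ lam β γ c).hamiltonian N y) ^ 2).toNNReal
  have hWc : Continuous W := continuous_real_toNNReal.comp ((continuous_const.add hHc).pow 2)
  have hcpt : ∀ R : ℝ≥0, IsCompact {x | W x ≤ R} := by
    intro R
    refine (cellChain_isCompact_hamiltonian_le hω hl hβ γ c N (R : ℝ)).of_isClosed_subset
      (isClosed_le hWc continuous_const) fun x hx => ?_
    simp only [Set.mem_setOf_eq] at hx ⊢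
    have hx' : (1 + (cellChain ω₂ lam β γ c).hamiltonian N x) ^ 2 ≤ R :=
      Real.toNNReal_le_iff_le_coe.1 hx
    have hH0 := cellChain_hamiltonian_nonneg hω.le hl hβ γ c N x
    nlinarith
  have hC' : ∀ n : ℕ, ∫⁻ s in Ioc (0:ℝ) (n + 1), ∫⁻ y, (W y : ℝ≥0∞) ∂(S.kernel s.toNNReal x₀) ≤
      ((n : ℝ≥0∞) + 1) * (C : ℝ≥0∞) := fun n => hC n
  -- Krylov–Bogoliubov from the Cesàro bound
  obtain ⟨μ, hμP, hinv, hWμ⟩ := MarkovSemigroup.exists_invariant_of_cesaro_bound S.kernel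
    S.kernel_add S.measurable_kernel hFeller W hWc hcpt ENNReal.coe_ne_top x₀ hC'
  refine ⟨μ, hμP, fun f hf hfc => ?_, fun i => ?_⟩
  · -- weak stationarity: Dynkin + invariance
    have hf2 : ContDiff ℝ 2 f := hf.of_le (by norm_cast)
    exact MarkovSemigroupFor.IsInvariant.integral_generator_eq_zero S hinv hf hfc
      (siteChain_continuous_generator _ hU1 hV1 N T_L T_R hf2).stronglyMeasurable
      ((siteChain_continuous_generator _ hU1 hV1 N T_L T_R hf2).bounded_above_of_compact_support
        (siteChain_hasCompactSupport_generator _ N T_L T_R hf2 hfc))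
  · -- integrable currents: `|j_i| ≤ N(3+β)/2 (1+H)²` and `∫ (1+H)² dμ ≤ C`
    have hint : Integrable (fun x => (1 + (cellChain ω₂ lam β γ c).hamiltonian N x) ^ 2) μ := by
      refine ⟨((continuous_const.add hHc).pow 2).aestronglyMeasurable, ?_⟩
      rw [hasFiniteIntegral_iff_ofReal (Filter.Eventually.of_forall fun x => sq_nonneg _)]
      exact lt_of_le_of_lt hWμ ENNReal.coe_lt_top
    refine (hint.const_mul ((N : ℝ) * ((3 + β) / 2))).mono'
      (cellChain_continuous_bondCurrent ω₂ lam β γ c N i).aestronglyMeasurable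
      (Filter.Eventually.of_forall fun x => ?_)
    rw [Real.norm_eq_abs]
    calc |(cellChain ω₂ lam β γ c).bondCurrent N i x|
        ≤ N * ((3 + β) / 2 * (1 + (cellChain ω₂ lam β γ c).hamiltonian N x) ^ 2) :=
          cellChain_abs_bondCurrent_le hω.le hl hβ γ c N i x
      _ = N * ((3 + β) / 2) * (1 + (cellChain ω₂ lam β γ c).hamiltonian N x) ^ 2 := by ring

end Summit.AtomisticToContinuum.FouriersLaw.Theorems.PrefixSteadyStates.LineRegistered

end
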